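import Literature.MathematicalPhysics.QuantumFieldTheory.Balaban1983to89.B4Eq19LatticeOperators
import HarnessLib

/-!
# Line «sandwich_discharge» on crux `HistoryTailL` (stmt-QuantumFields-19936), stub `stub_sandwichSweepGapCapped` (S′), brick B5 on `ℤ³` —
# (Z-a) «LATTICE FORMS IN DEGREES 1–3 ON `ℤ^d`»: the cubical exterior derivatives `d₀, d₁ = curl, d₂` and their transposes `δ₁ = ∂*, δ₂, δ₃`
# written as EXPLICIT SIGNED SUMS (no `def`), `d ∘ d = 0`, the componentwise HODGE IDENTITIES `dδ + δd = −Δ` in degrees 0, 1, 2, and the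
# finite ADJOINTNESS (summation by parts) of `d₀ ∕ δ₁`, `d₁ ∕ δ₂`, `d₂ ∕ δ₃` on boxes of `ℤ^d`

Cell `ym3-torus` (YM ladder rung R3 = continuum SU(2) Yang–Mills on the three-torus — a RUNG, NOT the Clay problem: not d = 4, not infinite volume,
not a mass gap); WIDTH helper seat `ym3-torus-px6` gen 8; `--supports stmt-QuantumFields-19936` (helper).  THEOREMS ONLY (0 `def`, default heartbeats),
in the `ℤ^d` letters of lit ✓`B4Eq19LatticeOperators` (`Zd`, `unitVec`, `box`, `sum_box_shift_of_support`).

WHY (w8 g8 LOCATE-B5-Z3-COMMUTATOR, 19936 evidence #47, §2 and §6 brick (Z-a); px8 g6 ARCH-S′ §3).  Brick B5 of the capped sweep stub builds the sweep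
amplitude `a := δ₂β`, `β := G₀ ∗ ω`, from the dipole-matched averaged-plaquette 2-form `ω` on `ℤ³`; the two algebraic facts it rests on are the OPERATOR
Hodge identity on 2-forms `d₁δ₂ + δ₃d₂ = (−Δ) ⊗ 1` (so `d a = ω − δ₃ d₂ β` once `(−Δ)β = ω`) and the finite adjointness `⟨δ₃ψ, F⟩ = ⟨ψ, "∇F"⟩ = ⅓⟨ψ, d₂F⟩`
(so the bulk term of the commutator truncation vanishes against a `d₂`-closed `F`).  THIS FILE types them, text-independent of the stub and of bricks
(Z-b)…(Z-e).  CONVENTIONS (all operators appear as FREE FUNCTION SYMBOLS constrained by a pointwise defining hypothesis, so a consumer instantiates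
with its own closed form and discharges the hypothesis by `fun _ .. => rfl`):
* 0-forms `f : Zd d → ℝ`; 1-forms `a : Zd d → Fin d → ℝ` (`a x μ` on the bond `⟨x, x + e_μ⟩`); 2-forms `F : Zd d → Fin d → Fin d → ℝ` (`F x μ ν` on the
  plaquette at `x` spanned by `e_μ, e_ν`; antisymmetry is assumed ONLY where stated); 3-forms `H : Zd d → Fin d → Fin d → Fin d → ℝ`.
* `(d₀f)(x,μ) = f(x+e_μ) − f(x)` (= lit `fdiff`); `(d₁a)(x,μ,ν) = [a(x+e_μ,ν) − a(x,ν)] − [a(x+e_ν,μ) − a(x,μ)]` (= lit `B16Ineq178TreeGauge.curl a x μ ν`);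
  `(d₂F)(x,κ,μ,ν) = [F(x+e_κ,μ,ν) − F(x,μ,ν)] − [F(x+e_μ,κ,ν) − F(x,κ,ν)] + [F(x+e_ν,κ,μ) − F(x,κ,μ)]` (ALTERNATING form; in `d = 3` its `(0,1,2)`
  component is `∇₀F₁₂ − ∇₁F₀₂ + ∇₂F₀₁`, the cube divergence ∕ abelian Bianchi expression);
* `(δ₁a)(x) = Σ_μ [a(x−e_μ,μ) − a(x,μ)]` (= lit `dvg`); `(δ₂F)(x,ν) = Σ_μ [F(x−e_μ,μ,ν) − F(x,μ,ν)]`; `(δ₃H)(x,μ,ν) = Σ_κ [H(x−e_κ,κ,μ,ν) − H(x,κ,μ,ν)]`;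
* `(−Δ u)(x) = Σ_κ [2u(x) − u(x+e_κ) − u(x−e_κ)]` (= lit `lop 0`).
WHAT IS PROVED (all `d`; EVERY `F` unless «antisymmetric» is written; also checked by exact integer arithmetic on `(ℤ∕5)³`, `(ℤ∕3)⁴`, script in HOME):
§1 `d₁∘d₀ = 0`, `d₂∘d₁ = 0` (pointwise); §2 HODGE `δ₁d₀ = −Δ` (0-forms), `d₀δ₁ + δ₂d₁ = −Δ ⊗ 1` (1-forms), ★`d₁δ₂ + δ₃d₂ = −Δ ⊗ 1` (2-forms; NO antisymmetry
needed with the alternating `d₂`), per summand `κ` and summed; §3 ADJOINTNESS ON A BOX `Q_R(z)`, the compactly supported factor vanishing off `Q_{R−1}(z)`: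
`Σ φ·δ₁g = Σ g·d₀φ` (support on `g`; twin of lit `sum_mul_dvg`), `Σ (δ₂F)·A = Σ F·∇A` (support on `F` or on `A`) `= ½ Σ F·d₁A` for antisymmetric `F`,
★`Σ (δ₃ψ)·F = Σ ψ·∇F` (support on `ψ`), `Σ ψ·d₂F = 3 Σ ψ·∇F` for totally antisymmetric `ψ`, hence `Σ (δ₃ψ)·F = 0` when `d₂F = 0` on `Q_{R−1}(z)`;
§4 the `d = 3` reading (antisymmetric `F`: `(d₂F)(x,κ,κ,ν) = (d₂F)(x,κ,μ,κ) = 0`, so `(δ₃d₂F)(x,μ,ν)` reads the single component `κ ∉ {μ,ν}`; `d₂F` is one scalar).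
PRIOR ART IN THE TREE (same conventions, stated for the DEFINED operators `LatticeForm.d₀∕d₁∕d₂` of lit ✓`CubicalCochains` and `LatticeChain.div₂∕div₃∕negLap₂`
of lit ✓`CubicalChainsHodge` on `Site d = Zd d`, `e = unitVec`): §1 is lit ✓`LatticeForm.d₁_d₀`∕`d₂_d₁` and §2's degree-two identity is lit
✓`LatticeChain.div₃_d₂_add_d₁_div₂` (Fröhlich–Spencer's `−Δ = dδ + δd`), here re-proved in the FREE-SYMBOL form the B5 knit instantiates by `rfl`; the
ADJOINTNESS rows of §3 are NOT in those files («not proved in this file», loc. cit.) and §4 is new bookkeeping.  HONEST SCOPE: elementary finite-sum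
identities ([folklore]; the cubical cochain complex of `ℤ^d` is the `d`-fold tensor product of the two-term complex of `ℤ`, whose Hodge Laplacians are
the scalar second difference); NOTHING here proves B5, the capped stub, `HistoryTailL`, or any summit statement; YM₃ on T³ is rung R3, not Clay.
-/

noncomputable section

open scoped BigOperators
open Finset

namespace Summit.QuantumFields.YangMills.Theorems.CovariantDischargeLatticeFormsDeg23

open Literature.MathematicalPhysics.QuantumFieldTheory.Balaban1983to89.B4Eq19LatticeOperators

variable {d : ℕ}

/-! ## §0 Site arithmetic on `ℤ^d` (the three normal forms used below) -/

/-- `x + e_μ + e_ν = x + e_ν + e_μ`. [folklore] -/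
theorem add_unitVec_add_unitVec_comm (x : Zd d) (μ ν : Fin d) : x + unitVec μ + unitVec ν = x + unitVec ν + unitVec μ :=
  add_right_comm _ _ _

/-- `x + e_μ − e_κ = x − e_κ + e_μ`. [folklore] -/
theorem add_unitVec_sub_unitVec (x : Zd d) (μ κ : Fin d) : x + unitVec μ - unitVec κ = x - unitVec κ + unitVec μ :=
  add_sub_right_comm _ _ _

/-- `x − e_κ + e_κ = x`. [folklore] -/
theorem sub_unitVec_add_unitVec (x : Zd d) (κ : Fin d) : x - unitVec κ + unitVec κ = x := sub_add_cancel _ _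

/-! ## §1 `d ∘ d = 0` -/

/-- **`d₁ ∘ d₀ = 0`**: the curl of a lattice gradient vanishes identically (free-symbol form of lit ✓`LatticeForm.d₁_d₀`). [folklore] -/
theorem curl_grad_eq_zero (f : Zd d → ℝ) (a : Zd d → Fin d → ℝ) (ha : ∀ x μ, a x μ = f (x + unitVec μ) - f x)
    (x : Zd d) (μ ν : Fin d) :
    (a (x + unitVec μ) ν - a x ν) - (a (x + unitVec ν) μ - a x μ) = 0 := by
  simp only [ha]; rw [add_unitVec_add_unitVec_comm x ν μ]; ring

/-- **`d₂ ∘ d₁ = 0`** (the abelian Bianchi identity): the alternating cube derivative of a lattice curl vanishes identically, for EVERY 1-form `a`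
(no closedness, no antisymmetry hypothesis — a polynomial identity in the twelve values of `a` on the edges of the cube; free-symbol form of lit
✓`LatticeForm.d₂_d₁`). [folklore] -/
theorem dTwo_curl_eq_zero (a : Zd d → Fin d → ℝ) (F : Zd d → Fin d → Fin d → ℝ)
    (hF : ∀ x μ ν, F x μ ν = (a (x + unitVec μ) ν - a x ν) - (a (x + unitVec ν) μ - a x μ))
    (x : Zd d) (κ μ ν : Fin d) :
    (F (x + unitVec κ) μ ν - F x μ ν) - (F (x + unitVec μ) κ ν - F x κ ν) + (F (x + unitVec ν) κ μ - F x κ μ) = 0 := by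
  simp only [hF]; rw [add_unitVec_add_unitVec_comm x μ κ, add_unitVec_add_unitVec_comm x ν κ, add_unitVec_add_unitVec_comm x ν μ]; ring

/-- The curl is antisymmetric: `(d₁a)(x,ν,μ) = −(d₁a)(x,μ,ν)`; in particular its diagonal vanishes. [folklore] -/
theorem curl_swap (a : Zd d → Fin d → ℝ) (F : Zd d → Fin d → Fin d → ℝ)
    (hF : ∀ x μ ν, F x μ ν = (a (x + unitVec μ) ν - a x ν) - (a (x + unitVec ν) μ - a x μ)) (x : Zd d) (μ ν : Fin d) :
    F x ν μ = -F x μ ν := by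
  simp only [hF]; ring

/-- The alternating cube derivative of ANY 2-form is antisymmetric in its last two indices. [folklore] -/
theorem dTwo_swap_right (F : Zd d → Fin d → Fin d → ℝ) (dF : Zd d → Fin d → Fin d → Fin d → ℝ)
    (hdF : ∀ x κ μ ν, dF x κ μ ν = (F (x + unitVec κ) μ ν - F x μ ν) - (F (x + unitVec μ) κ ν - F x κ ν) + (F (x + unitVec ν) κ μ - F x κ μ))
    (hanti : ∀ x μ ν, F x ν μ = -F x μ ν) (x : Zd d) (κ μ ν : Fin d) : dF x κ ν μ = -dF x κ μ ν := by
  simp only [hdF]; rw [hanti x ν μ, hanti (x + unitVec κ) ν μ]; ring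

/-- The alternating cube derivative of an ANTISYMMETRIC 2-form is antisymmetric in its first two indices (hence totally antisymmetric). [folklore] -/
theorem dTwo_swap_left (F : Zd d → Fin d → Fin d → ℝ) (dF : Zd d → Fin d → Fin d → Fin d → ℝ)
    (hdF : ∀ x κ μ ν, dF x κ μ ν = (F (x + unitVec κ) μ ν - F x μ ν) - (F (x + unitVec μ) κ ν - F x κ ν) + (F (x + unitVec ν) κ μ - F x κ μ))
    (hanti : ∀ x μ ν, F x ν μ = -F x μ ν) (x : Zd d) (κ μ ν : Fin d) : dF x μ κ ν = -dF x κ μ ν := by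
  simp only [hdF]; rw [hanti x μ κ, hanti (x + unitVec ν) μ κ]; ring

/-- For a 2-form with ZERO DIAGONAL the alternating cube derivative vanishes on a repeated first∕second index: `(d₂F)(x,κ,κ,ν) = 0`. [folklore] -/
theorem dTwo_diag_left (F : Zd d → Fin d → Fin d → ℝ) (dF : Zd d → Fin d → Fin d → Fin d → ℝ)
    (hdF : ∀ x κ μ ν, dF x κ μ ν = (F (x + unitVec κ) μ ν - F x μ ν) - (F (x + unitVec μ) κ ν - F x κ ν) + (F (x + unitVec ν) κ μ - F x κ μ))
    (hdiag : ∀ x μ, F x μ μ = 0) (x : Zd d) (κ ν : Fin d) : dF x κ κ ν = 0 := by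
  simp only [hdF, hdiag]; ring

/-- An antisymmetric 2-form has zero diagonal. [folklore] -/
theorem diag_eq_zero_of_anti (F : Zd d → Fin d → Fin d → ℝ) (hanti : ∀ x μ ν, F x ν μ = -F x μ ν) (x : Zd d) (μ : Fin d) :
    F x μ μ = 0 := by
  have h := hanti x μ μ; linarith

/-- For an ANTISYMMETRIC 2-form the alternating cube derivative vanishes on a repeated outer index: `(d₂F)(x,κ,μ,κ) = 0`. [folklore] -/
theorem dTwo_diag_outer (F : Zd d → Fin d → Fin d → ℝ) (dF : Zd d → Fin d → Fin d → Fin d → ℝ)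
    (hdF : ∀ x κ μ ν, dF x κ μ ν = (F (x + unitVec κ) μ ν - F x μ ν) - (F (x + unitVec μ) κ ν - F x κ ν) + (F (x + unitVec ν) κ μ - F x κ μ))
    (hanti : ∀ x μ ν, F x ν μ = -F x μ ν) (x : Zd d) (κ μ : Fin d) : dF x κ μ κ = 0 := by
  simp only [hdF]
  rw [hanti x κ μ, hanti (x + unitVec κ) κ μ, diag_eq_zero_of_anti F hanti x κ, diag_eq_zero_of_anti F hanti (x + unitVec μ) κ]
  ring

/-- The transpose `δ₃` of an (arbitrary) 3-form antisymmetric in its last two indices is an antisymmetric 2-form. [folklore] -/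
theorem deltaThree_swap (H : Zd d → Fin d → Fin d → Fin d → ℝ) (δH : Zd d → Fin d → Fin d → ℝ)
    (hδH : ∀ x μ ν, δH x μ ν = ∑ κ, (H (x - unitVec κ) κ μ ν - H x κ μ ν))
    (hanti : ∀ x κ μ ν, H x κ ν μ = -H x κ μ ν) (x : Zd d) (μ ν : Fin d) : δH x ν μ = -δH x μ ν := by
  simp only [hδH, ← Finset.sum_neg_distrib]
  exact Finset.sum_congr rfl fun κ _ => by rw [hanti, hanti x]; ring

/-! ## §2 The Hodge identities `dδ + δd = −Δ` (componentwise, pointwise, all of `ℤ^d`) -/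

/-- **Degree 0**: `δ₁ d₀ f = −Δ f`, i.e. `Σ_κ [(f(x−e_κ+e_κ) − f(x−e_κ)) − (f(x+e_κ) − f(x))] = Σ_κ [2f(x) − f(x+e_κ) − f(x−e_κ)]` (= lit `lop 0 f x`). [folklore] -/
theorem hodge_zero (f : Zd d → ℝ) (a : Zd d → Fin d → ℝ) (ha : ∀ x μ, a x μ = f (x + unitVec μ) - f x) (x : Zd d) :
    ∑ κ, (a (x - unitVec κ) κ - a x κ) = ∑ κ, (2 * f x - f (x + unitVec κ) - f (x - unitVec κ)) := by
  exact Finset.sum_congr rfl fun κ _ => by simp only [ha, sub_unitVec_add_unitVec]; ring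

/-- **Degree 1, summand**: the `κ`-th summand of `(d₀δ₁a + δ₂d₁a)(x,μ)` equals `2a(x,μ) − a(x+e_κ,μ) − a(x−e_κ,μ)` — an identity in eight values of `a`.
[folklore] -/
theorem hodge_one_summand (a : Zd d → Fin d → ℝ) (x : Zd d) (μ κ : Fin d) :
    (a (x + unitVec μ - unitVec κ) κ - a (x + unitVec μ) κ) - (a (x - unitVec κ) κ - a x κ)
      + (((a (x - unitVec κ + unitVec κ) μ - a (x - unitVec κ) μ) - (a (x - unitVec κ + unitVec μ) κ - a (x - unitVec κ) κ))
        - ((a (x + unitVec κ) μ - a x μ) - (a (x + unitVec μ) κ - a x κ)))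
      = 2 * a x μ - a (x + unitVec κ) μ - a (x - unitVec κ) μ := by
  rw [add_unitVec_sub_unitVec, sub_unitVec_add_unitVec]; ring

/-- ★ **Degree 1 (HODGE IDENTITY ON 1-FORMS)**: `(d₀δ₁a)(x,μ) + (δ₂d₁a)(x,μ) = (−Δ a_μ)(x)` for EVERY 1-form `a` — with `δa := δ₁a` (lit `dvg`) and `da := d₁a`
(curl) entered as defining hypotheses. [folklore] -/
theorem hodge_one (a : Zd d → Fin d → ℝ) (δa : Zd d → ℝ) (da : Zd d → Fin d → Fin d → ℝ)
    (hδa : ∀ x, δa x = ∑ κ, (a (x - unitVec κ) κ - a x κ))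
    (hda : ∀ x μ ν, da x μ ν = (a (x + unitVec μ) ν - a x ν) - (a (x + unitVec ν) μ - a x μ))
    (x : Zd d) (μ : Fin d) :
    (δa (x + unitVec μ) - δa x) + ∑ κ, (da (x - unitVec κ) κ μ - da x κ μ)
      = ∑ κ, (2 * a x μ - a (x + unitVec κ) μ - a (x - unitVec κ) μ) := by
  simp only [hδa, hda, ← Finset.sum_sub_distrib, ← Finset.sum_add_distrib]
  exact Finset.sum_congr rfl fun κ _ => hodge_one_summand a x μ κ

/-- **Degree 2, summand**: the `κ`-th summand of `(d₁δ₂F + δ₃d₂F)(x,μ,ν)` equals `2F(x,μ,ν) − F(x+e_κ,μ,ν) − F(x−e_κ,μ,ν)` — an identity in the values of an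
ARBITRARY 2-form `F` (alternating `d₂`; no antisymmetry). [folklore] -/
theorem hodge_two_summand (F : Zd d → Fin d → Fin d → ℝ) (x : Zd d) (μ ν κ : Fin d) :
    ((F (x + unitVec μ - unitVec κ) κ ν - F (x + unitVec μ) κ ν) - (F (x - unitVec κ) κ ν - F x κ ν))
      - ((F (x + unitVec ν - unitVec κ) κ μ - F (x + unitVec ν) κ μ) - (F (x - unitVec κ) κ μ - F x κ μ))
      + (((F (x - unitVec κ + unitVec κ) μ ν - F (x - unitVec κ) μ ν) - (F (x - unitVec κ + unitVec μ) κ ν - F (x - unitVec κ) κ ν)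
            + (F (x - unitVec κ + unitVec ν) κ μ - F (x - unitVec κ) κ μ))
          - ((F (x + unitVec κ) μ ν - F x μ ν) - (F (x + unitVec μ) κ ν - F x κ ν) + (F (x + unitVec ν) κ μ - F x κ μ)))
      = 2 * F x μ ν - F (x + unitVec κ) μ ν - F (x - unitVec κ) μ ν := by
  rw [add_unitVec_sub_unitVec, add_unitVec_sub_unitVec, sub_unitVec_add_unitVec]; ring

/-- ★★ **Degree 2 (HODGE IDENTITY ON 2-FORMS)**: `(d₁δ₂F)(x,μ,ν) + (δ₃d₂F)(x,μ,ν) = (−Δ F_{μν})(x) = Σ_κ [2F(x,μ,ν) − F(x+e_κ,μ,ν) − F(x−e_κ,μ,ν)]` for EVERY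
2-form `F` on `ℤ^d`, pointwise — with `δF := δ₂F` and `dF := d₂F` (alternating) entered as defining hypotheses; the free-symbol form of lit
✓`LatticeChain.div₃_d₂_add_d₁_div₂` (`div₃ (d₂ M) + d₁ (div₂ M) = negLap₂ M`, Fröhlich–Spencer CMP 83 §2.5).  (Consumer: with `F := β = G₀ ∗ ω` and
`(−Δ)β = ω` this is `d₁(δ₂β) = ω − δ₃(d₂β)`.) [folklore] -/
theorem hodge_two (F : Zd d → Fin d → Fin d → ℝ) (δF : Zd d → Fin d → ℝ) (dF : Zd d → Fin d → Fin d → Fin d → ℝ)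
    (hδF : ∀ x ν, δF x ν = ∑ μ, (F (x - unitVec μ) μ ν - F x μ ν))
    (hdF : ∀ x κ μ ν, dF x κ μ ν = (F (x + unitVec κ) μ ν - F x μ ν) - (F (x + unitVec μ) κ ν - F x κ ν) + (F (x + unitVec ν) κ μ - F x κ μ))
    (x : Zd d) (μ ν : Fin d) :
    ((δF (x + unitVec μ) ν - δF x ν) - (δF (x + unitVec ν) μ - δF x μ)) + ∑ κ, (dF (x - unitVec κ) κ μ ν - dF x κ μ ν)
      = ∑ κ, (2 * F x μ ν - F (x + unitVec κ) μ ν - F (x - unitVec κ) μ ν) := by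
  simp only [hδF, hdF, ← Finset.sum_sub_distrib, ← Finset.sum_add_distrib]
  exact Finset.sum_congr rfl fun κ _ => hodge_two_summand F x μ ν κ

/-- The Hodge identity on 2-forms read as `d₁δ₂F = (−Δ)F − δ₃d₂F` (the shape brick (Z-e) consumes: `d a = ω − δ₃γ` for `a = δ₂β`, `γ = d₂β`, `(−Δ)β = ω`).
[folklore] -/
theorem curl_deltaTwo_eq (F : Zd d → Fin d → Fin d → ℝ) (δF : Zd d → Fin d → ℝ) (dF : Zd d → Fin d → Fin d → Fin d → ℝ)
    (ω : Zd d → Fin d → Fin d → ℝ)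
    (hδF : ∀ x ν, δF x ν = ∑ μ, (F (x - unitVec μ) μ ν - F x μ ν))
    (hdF : ∀ x κ μ ν, dF x κ μ ν = (F (x + unitVec κ) μ ν - F x μ ν) - (F (x + unitVec μ) κ ν - F x κ ν) + (F (x + unitVec ν) κ μ - F x κ μ))
    (x : Zd d) (μ ν : Fin d) (hω : ω x μ ν = ∑ κ, (2 * F x μ ν - F (x + unitVec κ) μ ν - F (x - unitVec κ) μ ν)) :
    (δF (x + unitVec μ) ν - δF x ν) - (δF (x + unitVec ν) μ - δF x μ)
      = ω x μ ν - ∑ κ, (dF (x - unitVec κ) κ μ ν - dF x κ μ ν) := by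
  rw [hω, ← hodge_two F δF dF hδF hdF x μ ν]
  ring

/-! ## §3 Adjointness on boxes (summation by parts with the compactly supported factor inside `Q_{R−1}(z)`) -/

/-- **`Σ φ·(δ₁g) = Σ g·(d₀φ)` with the support on `g`**: for a bond function `g` vanishing off `Q_{R−1}(z)` and ANY `φ`,
`Σ_{y ∈ Q_R(z)} φ(y)·Σ_κ[g(y−e_κ,κ) − g(y,κ)] = Σ_{y ∈ Q_R(z)} Σ_κ g(y,κ)·[φ(y+e_κ) − φ(y)]` (the twin of lit `sum_mul_dvg`, where the support is on `φ`).
[folklore] -/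
theorem sum_mul_deltaOne_of_support (φ : Zd d → ℝ) (g : Zd d → Fin d → ℝ) (z : Zd d) (R : ℤ)
    (hg : ∀ y ∉ box z (R - 1), ∀ κ, g y κ = 0) :
    ∑ y ∈ box z R, φ y * ∑ κ, (g (y - unitVec κ) κ - g y κ) = ∑ y ∈ box z R, ∑ κ, g y κ * (φ (y + unitVec κ) - φ y) := by
  have key : ∀ κ : Fin d, ∑ y ∈ box z R, φ y * g (y - unitVec κ) κ = ∑ y ∈ box z R, φ (y + unitVec κ) * g y κ := by
    intro κ
    have h := sum_box_shift_of_support (F := fun y => φ (y + unitVec κ) * g y κ) (z := z) (R := R)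
      (fun y hy => by simp only [hg y hy κ, mul_zero]) (-unitVec κ) (fun i => by rw [Pi.neg_apply, abs_neg]; exact abs_unitVec_apply_le κ i)
    simp only [← sub_eq_add_neg, sub_add_cancel] at h
    exact h
  calc ∑ y ∈ box z R, φ y * ∑ κ, (g (y - unitVec κ) κ - g y κ)
      = ∑ y ∈ box z R, ∑ κ, (φ y * g (y - unitVec κ) κ - φ y * g y κ) := by
        refine Finset.sum_congr rfl fun y _ => ?_
        rw [Finset.mul_sum]
        exact Finset.sum_congr rfl fun κ _ => by ring
    _ = ∑ κ, ∑ y ∈ box z R, (φ y * g (y - unitVec κ) κ - φ y * g y κ) := Finset.sum_comm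
    _ = ∑ κ, ∑ y ∈ box z R, g y κ * (φ (y + unitVec κ) - φ y) := by
        refine Finset.sum_congr rfl fun κ _ => ?_
        rw [Finset.sum_sub_distrib, key κ, ← Finset.sum_sub_distrib]
        exact Finset.sum_congr rfl fun y _ => by ring
    _ = ∑ y ∈ box z R, ∑ κ, g y κ * (φ (y + unitVec κ) - φ y) := Finset.sum_comm

/-- **`Σ (δ₂F)·A = Σ F·∇A` with the support on `F`**: for a 2-form `F` vanishing off `Q_{R−1}(z)` and ANY 1-form `A`,
`Σ_{y ∈ Q_R(z)} Σ_ν (Σ_μ[F(y−e_μ,μ,ν) − F(y,μ,ν)])·A(y,ν) = Σ_{y ∈ Q_R(z)} Σ_μ Σ_ν F(y,μ,ν)·[A(y+e_μ,ν) − A(y,ν)]`. [folklore] -/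
theorem sum_deltaTwo_mul_of_support_left (F : Zd d → Fin d → Fin d → ℝ) (A : Zd d → Fin d → ℝ) (z : Zd d) (R : ℤ)
    (hF : ∀ y ∉ box z (R - 1), ∀ μ ν, F y μ ν = 0) :
    ∑ y ∈ box z R, ∑ ν, (∑ μ, (F (y - unitVec μ) μ ν - F y μ ν)) * A y ν
      = ∑ y ∈ box z R, ∑ μ, ∑ ν, F y μ ν * (A (y + unitVec μ) ν - A y ν) := by
  have key : ∀ ν : Fin d, ∑ y ∈ box z R, A y ν * ∑ μ, (F (y - unitVec μ) μ ν - F y μ ν)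
      = ∑ y ∈ box z R, ∑ μ, F y μ ν * (A (y + unitVec μ) ν - A y ν) := fun ν =>
    sum_mul_deltaOne_of_support (fun y => A y ν) (fun y μ => F y μ ν) z R (fun y hy μ => hF y hy μ ν)
  calc ∑ y ∈ box z R, ∑ ν, (∑ μ, (F (y - unitVec μ) μ ν - F y μ ν)) * A y ν
      = ∑ y ∈ box z R, ∑ ν, A y ν * ∑ μ, (F (y - unitVec μ) μ ν - F y μ ν) := Finset.sum_congr rfl fun y _ => Finset.sum_congr rfl fun ν _ => mul_comm _ _
    _ = ∑ ν, ∑ y ∈ box z R, A y ν * ∑ μ, (F (y - unitVec μ) μ ν - F y μ ν) := Finset.sum_comm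
    _ = ∑ ν, ∑ y ∈ box z R, ∑ μ, F y μ ν * (A (y + unitVec μ) ν - A y ν) := Finset.sum_congr rfl fun ν _ => key ν
    _ = ∑ y ∈ box z R, ∑ ν, ∑ μ, F y μ ν * (A (y + unitVec μ) ν - A y ν) := Finset.sum_comm
    _ = ∑ y ∈ box z R, ∑ μ, ∑ ν, F y μ ν * (A (y + unitVec μ) ν - A y ν) := Finset.sum_congr rfl fun y _ => Finset.sum_comm

/-- **`Σ F·∇A = Σ (δ₂F)·A` with the support on `A`**: for a 1-form `A` vanishing off `Q_{R−1}(z)` and ANY 2-form `F`,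
`Σ_{y ∈ Q_R(z)} Σ_μ Σ_ν F(y,μ,ν)·[A(y+e_μ,ν) − A(y,ν)] = Σ_{y ∈ Q_R(z)} Σ_ν (Σ_μ[F(y−e_μ,μ,ν) − F(y,μ,ν)])·A(y,ν)` (the shape `⟨d a_R, F⟩ = ⟨a_R, δ₂F⟩`
of the commutator truncation, `a_R` compactly supported, `F` arbitrary). [folklore] -/
theorem sum_mul_grad_of_support_right (F : Zd d → Fin d → Fin d → ℝ) (A : Zd d → Fin d → ℝ) (z : Zd d) (R : ℤ)
    (hA : ∀ y ∉ box z (R - 1), ∀ ν, A y ν = 0) :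
    ∑ y ∈ box z R, ∑ μ, ∑ ν, F y μ ν * (A (y + unitVec μ) ν - A y ν)
      = ∑ y ∈ box z R, ∑ ν, (∑ μ, (F (y - unitVec μ) μ ν - F y μ ν)) * A y ν := by
  have key : ∀ μ ν : Fin d, ∑ y ∈ box z R, F y μ ν * A (y + unitVec μ) ν = ∑ y ∈ box z R, F (y - unitVec μ) μ ν * A y ν := by
    intro μ ν
    have h := sum_box_shift_of_support (F := fun y => F (y - unitVec μ) μ ν * A y ν) (z := z) (R := R)
      (fun y hy => by simp only [hA y hy ν, mul_zero]) (unitVec μ) (abs_unitVec_apply_le μ)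
    simp only [add_sub_cancel_right] at h
    exact h
  symm
  calc ∑ y ∈ box z R, ∑ ν, (∑ μ, (F (y - unitVec μ) μ ν - F y μ ν)) * A y ν
      = ∑ y ∈ box z R, ∑ ν, ∑ μ, (F (y - unitVec μ) μ ν * A y ν - F y μ ν * A y ν) := by
        refine Finset.sum_congr rfl fun y _ => Finset.sum_congr rfl fun ν _ => ?_
        rw [Finset.sum_mul]
        exact Finset.sum_congr rfl fun μ _ => by ring
    _ = ∑ y ∈ box z R, ∑ μ, ∑ ν, (F (y - unitVec μ) μ ν * A y ν - F y μ ν * A y ν) := Finset.sum_congr rfl fun y _ => Finset.sum_comm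
    _ = ∑ μ, ∑ y ∈ box z R, ∑ ν, (F (y - unitVec μ) μ ν * A y ν - F y μ ν * A y ν) := Finset.sum_comm
    _ = ∑ μ, ∑ ν, ∑ y ∈ box z R, (F (y - unitVec μ) μ ν * A y ν - F y μ ν * A y ν) := Finset.sum_congr rfl fun μ _ => Finset.sum_comm
    _ = ∑ μ, ∑ ν, ∑ y ∈ box z R, F y μ ν * (A (y + unitVec μ) ν - A y ν) := by
        refine Finset.sum_congr rfl fun μ _ => Finset.sum_congr rfl fun ν _ => ?_
        rw [Finset.sum_sub_distrib, ← key μ ν, ← Finset.sum_sub_distrib]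
        exact Finset.sum_congr rfl fun y _ => by ring
    _ = ∑ μ, ∑ y ∈ box z R, ∑ ν, F y μ ν * (A (y + unitVec μ) ν - A y ν) := Finset.sum_congr rfl fun μ _ => Finset.sum_comm
    _ = ∑ y ∈ box z R, ∑ μ, ∑ ν, F y μ ν * (A (y + unitVec μ) ν - A y ν) := Finset.sum_comm

/-- For an ANTISYMMETRIC 2-form the raw pairing `Σ_μ Σ_ν F(y,μ,ν)·[A(y+e_μ,ν) − A(y,ν)]` is `½ Σ_μ Σ_ν F(y,μ,ν)·(d₁A)(y,μ,ν)` (pointwise in `y`). [folklore] -/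
theorem sum_mul_grad_eq_half_sum_mul_curl (F : Zd d → Fin d → Fin d → ℝ) (A : Zd d → Fin d → ℝ) (dA : Zd d → Fin d → Fin d → ℝ)
    (hdA : ∀ x μ ν, dA x μ ν = (A (x + unitVec μ) ν - A x ν) - (A (x + unitVec ν) μ - A x μ))
    (hanti : ∀ x μ ν, F x ν μ = -F x μ ν) (y : Zd d) :
    ∑ μ, ∑ ν, F y μ ν * (A (y + unitVec μ) ν - A y ν) = (1 / 2) * ∑ μ, ∑ ν, F y μ ν * dA y μ ν := by
  have hsplit : ∑ μ, ∑ ν, F y μ ν * dA y μ ν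
      = (∑ μ, ∑ ν, F y μ ν * (A (y + unitVec μ) ν - A y ν)) - ∑ μ, ∑ ν, F y μ ν * (A (y + unitVec ν) μ - A y μ) := by
    simp only [hdA, mul_sub, Finset.sum_sub_distrib]
  have hswap : ∑ μ, ∑ ν, F y μ ν * (A (y + unitVec ν) μ - A y μ) = -∑ μ, ∑ ν, F y μ ν * (A (y + unitVec μ) ν - A y ν) := by
    rw [Finset.sum_comm, ← Finset.sum_neg_distrib]
    refine Finset.sum_congr rfl fun μ _ => ?_
    rw [← Finset.sum_neg_distrib]
    exact Finset.sum_congr rfl fun ν _ => by rw [hanti y μ ν]; ring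
  rw [hsplit, hswap]
  ring

/-- ★ **`Σ (δ₃ψ)·F = Σ ψ·∇F` with the support on `ψ`**: for a 3-form `ψ` vanishing off `Q_{R−1}(z)` and ANY 2-form `F`,
`Σ_{y ∈ Q_R(z)} Σ_μ Σ_ν (Σ_κ[ψ(y−e_κ,κ,μ,ν) − ψ(y,κ,μ,ν)])·F(y,μ,ν) = Σ_{y ∈ Q_R(z)} Σ_κ Σ_μ Σ_ν ψ(y,κ,μ,ν)·[F(y+e_κ,μ,ν) − F(y,μ,ν)]`. [folklore] -/
theorem sum_deltaThree_mul_of_support (ψ : Zd d → Fin d → Fin d → Fin d → ℝ) (F : Zd d → Fin d → Fin d → ℝ) (z : Zd d) (R : ℤ)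
    (hψ : ∀ y ∉ box z (R - 1), ∀ κ μ ν, ψ y κ μ ν = 0) :
    ∑ y ∈ box z R, ∑ μ, ∑ ν, (∑ κ, (ψ (y - unitVec κ) κ μ ν - ψ y κ μ ν)) * F y μ ν
      = ∑ y ∈ box z R, ∑ κ, ∑ μ, ∑ ν, ψ y κ μ ν * (F (y + unitVec κ) μ ν - F y μ ν) := by
  have key : ∀ μ ν : Fin d, ∑ y ∈ box z R, F y μ ν * ∑ κ, (ψ (y - unitVec κ) κ μ ν - ψ y κ μ ν)
      = ∑ y ∈ box z R, ∑ κ, ψ y κ μ ν * (F (y + unitVec κ) μ ν - F y μ ν) := fun μ ν =>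
    sum_mul_deltaOne_of_support (fun y => F y μ ν) (fun y κ => ψ y κ μ ν) z R (fun y hy κ => hψ y hy κ μ ν)
  calc ∑ y ∈ box z R, ∑ μ, ∑ ν, (∑ κ, (ψ (y - unitVec κ) κ μ ν - ψ y κ μ ν)) * F y μ ν
      = ∑ y ∈ box z R, ∑ μ, ∑ ν, F y μ ν * ∑ κ, (ψ (y - unitVec κ) κ μ ν - ψ y κ μ ν) :=
        Finset.sum_congr rfl fun y _ => Finset.sum_congr rfl fun μ _ => Finset.sum_congr rfl fun ν _ => mul_comm _ _
    _ = ∑ μ, ∑ y ∈ box z R, ∑ ν, F y μ ν * ∑ κ, (ψ (y - unitVec κ) κ μ ν - ψ y κ μ ν) := Finset.sum_comm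
    _ = ∑ μ, ∑ ν, ∑ y ∈ box z R, F y μ ν * ∑ κ, (ψ (y - unitVec κ) κ μ ν - ψ y κ μ ν) := Finset.sum_congr rfl fun μ _ => Finset.sum_comm
    _ = ∑ μ, ∑ ν, ∑ y ∈ box z R, ∑ κ, ψ y κ μ ν * (F (y + unitVec κ) μ ν - F y μ ν) := Finset.sum_congr rfl fun μ _ => Finset.sum_congr rfl fun ν _ => key μ ν
    _ = ∑ μ, ∑ ν, ∑ κ, ∑ y ∈ box z R, ψ y κ μ ν * (F (y + unitVec κ) μ ν - F y μ ν) :=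
        Finset.sum_congr rfl fun μ _ => Finset.sum_congr rfl fun ν _ => Finset.sum_comm
    _ = ∑ μ, ∑ κ, ∑ ν, ∑ y ∈ box z R, ψ y κ μ ν * (F (y + unitVec κ) μ ν - F y μ ν) := Finset.sum_congr rfl fun μ _ => Finset.sum_comm
    _ = ∑ κ, ∑ μ, ∑ ν, ∑ y ∈ box z R, ψ y κ μ ν * (F (y + unitVec κ) μ ν - F y μ ν) := Finset.sum_comm
    _ = ∑ κ, ∑ μ, ∑ y ∈ box z R, ∑ ν, ψ y κ μ ν * (F (y + unitVec κ) μ ν - F y μ ν) :=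
        Finset.sum_congr rfl fun κ _ => Finset.sum_congr rfl fun μ _ => Finset.sum_comm
    _ = ∑ κ, ∑ y ∈ box z R, ∑ μ, ∑ ν, ψ y κ μ ν * (F (y + unitVec κ) μ ν - F y μ ν) := Finset.sum_congr rfl fun κ _ => Finset.sum_comm
    _ = ∑ y ∈ box z R, ∑ κ, ∑ μ, ∑ ν, ψ y κ μ ν * (F (y + unitVec κ) μ ν - F y μ ν) := Finset.sum_comm

/-- **`Σ ψ·d₂F = 3·Σ ψ·∇F` for a TOTALLY ANTISYMMETRIC 3-form `ψ`** (pointwise in `y`, ANY 2-form `F`, alternating `d₂`): the three terms of `d₂F` contribute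
equally after relabelling. [folklore] -/
theorem sum_mul_dTwo_eq_three_mul (ψ : Zd d → Fin d → Fin d → Fin d → ℝ) (F : Zd d → Fin d → Fin d → ℝ)
    (dF : Zd d → Fin d → Fin d → Fin d → ℝ)
    (hdF : ∀ x κ μ ν, dF x κ μ ν = (F (x + unitVec κ) μ ν - F x μ ν) - (F (x + unitVec μ) κ ν - F x κ ν) + (F (x + unitVec ν) κ μ - F x κ μ))
    (hanti₁ : ∀ x κ μ ν, ψ x μ κ ν = -ψ x κ μ ν) (hanti₂ : ∀ x κ μ ν, ψ x κ ν μ = -ψ x κ μ ν) (y : Zd d) :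
    ∑ κ, ∑ μ, ∑ ν, ψ y κ μ ν * dF y κ μ ν = 3 * ∑ κ, ∑ μ, ∑ ν, ψ y κ μ ν * (F (y + unitVec κ) μ ν - F y μ ν) := by
  -- the three pieces of `d₂F`
  have hsplit : ∑ κ, ∑ μ, ∑ ν, ψ y κ μ ν * dF y κ μ ν
      = (∑ κ, ∑ μ, ∑ ν, ψ y κ μ ν * (F (y + unitVec κ) μ ν - F y μ ν))
        - (∑ κ, ∑ μ, ∑ ν, ψ y κ μ ν * (F (y + unitVec μ) κ ν - F y κ ν))
        + ∑ κ, ∑ μ, ∑ ν, ψ y κ μ ν * (F (y + unitVec ν) κ μ - F y κ μ) := by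
    simp only [hdF, mul_add, mul_sub, Finset.sum_add_distrib, Finset.sum_sub_distrib]
  -- second piece: swap `κ ↔ μ`
  have h2 : ∑ κ, ∑ μ, ∑ ν, ψ y κ μ ν * (F (y + unitVec μ) κ ν - F y κ ν)
      = -∑ κ, ∑ μ, ∑ ν, ψ y κ μ ν * (F (y + unitVec κ) μ ν - F y μ ν) := by
    rw [Finset.sum_comm, ← Finset.sum_neg_distrib]
    refine Finset.sum_congr rfl fun κ _ => ?_
    rw [← Finset.sum_neg_distrib]
    refine Finset.sum_congr rfl fun μ _ => ?_
    rw [← Finset.sum_neg_distrib]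
    exact Finset.sum_congr rfl fun ν _ => by rw [hanti₁ y κ μ ν]; ring
  -- third piece: cyclic relabelling `(κ, μ, ν) ↦ (μ, ν, κ)`
  have h3 : ∑ κ, ∑ μ, ∑ ν, ψ y κ μ ν * (F (y + unitVec ν) κ μ - F y κ μ)
      = ∑ κ, ∑ μ, ∑ ν, ψ y κ μ ν * (F (y + unitVec κ) μ ν - F y μ ν) := by
    symm
    calc ∑ κ, ∑ μ, ∑ ν, ψ y κ μ ν * (F (y + unitVec κ) μ ν - F y μ ν)
        = ∑ μ, ∑ κ, ∑ ν, ψ y κ μ ν * (F (y + unitVec κ) μ ν - F y μ ν) := Finset.sum_comm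
      _ = ∑ μ, ∑ ν, ∑ κ, ψ y κ μ ν * (F (y + unitVec κ) μ ν - F y μ ν) := Finset.sum_congr rfl fun μ _ => Finset.sum_comm
      _ = ∑ μ, ∑ ν, ∑ κ, ψ y μ ν κ * (F (y + unitVec κ) μ ν - F y μ ν) := by
          refine Finset.sum_congr rfl fun μ _ => Finset.sum_congr rfl fun ν _ => Finset.sum_congr rfl fun κ _ => ?_
          rw [show ψ y μ ν κ = ψ y κ μ ν by rw [hanti₂ y μ κ ν, hanti₁ y κ μ ν]; ring]
  rw [hsplit, h2, h3]
  ring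

/-- ★ **THE BULK TERM VANISHES**: for a totally antisymmetric 3-form `ψ` vanishing off `Q_{R−1}(z)` and a 2-form `F` whose alternating cube derivative
vanishes on `Q_{R−1}(z)`, `Σ_{y ∈ Q_R(z)} Σ_μ Σ_ν (δ₃ψ)(y,μ,ν)·F(y,μ,ν) = 0` (the shape `⟨δ₃(χ̂γ), F⟩ = ⟨χ̂γ, d₂F⟩ = 0` of the commutator truncation).
[folklore] -/
theorem sum_deltaThree_mul_eq_zero_of_dTwo_eq_zero (ψ : Zd d → Fin d → Fin d → Fin d → ℝ) (F : Zd d → Fin d → Fin d → ℝ)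
    (dF : Zd d → Fin d → Fin d → Fin d → ℝ) (z : Zd d) (R : ℤ)
    (hdF : ∀ x κ μ ν, dF x κ μ ν = (F (x + unitVec κ) μ ν - F x μ ν) - (F (x + unitVec μ) κ ν - F x κ ν) + (F (x + unitVec ν) κ μ - F x κ μ))
    (hanti₁ : ∀ x κ μ ν, ψ x μ κ ν = -ψ x κ μ ν) (hanti₂ : ∀ x κ μ ν, ψ x κ ν μ = -ψ x κ μ ν)
    (hψ : ∀ y ∉ box z (R - 1), ∀ κ μ ν, ψ y κ μ ν = 0) (hclosed : ∀ y ∈ box z (R - 1), ∀ κ μ ν, dF y κ μ ν = 0) :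
    ∑ y ∈ box z R, ∑ μ, ∑ ν, (∑ κ, (ψ (y - unitVec κ) κ μ ν - ψ y κ μ ν)) * F y μ ν = 0 := by
  rw [sum_deltaThree_mul_of_support ψ F z R hψ]
  refine Finset.sum_eq_zero fun y _ => ?_
  have h3 := sum_mul_dTwo_eq_three_mul ψ F dF hdF hanti₁ hanti₂ y
  have h0 : ∑ κ, ∑ μ, ∑ ν, ψ y κ μ ν * dF y κ μ ν = 0 := by
    by_cases hy : y ∈ box z (R - 1)
    · exact Finset.sum_eq_zero fun κ _ => Finset.sum_eq_zero fun μ _ => Finset.sum_eq_zero fun ν _ => by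
        rw [hclosed y hy, mul_zero]
    · exact Finset.sum_eq_zero fun κ _ => Finset.sum_eq_zero fun μ _ => Finset.sum_eq_zero fun ν _ => by
        rw [hψ y hy, zero_mul]
  linarith

/-! ## §4 The `d = 3` reading: an antisymmetric 2-form, `δ₃d₂` through the single component `κ ∉ {μ, ν}` -/

/-- In `d = 3`, for an ANTISYMMETRIC 2-form `F`, `(δ₃d₂F)(x,1,2) = (d₂F)(x−e₀,0,1,2) − (d₂F)(x,0,1,2)`. [folklore] -/
theorem deltaThree_dTwo_fin3_12 (F : Zd 3 → Fin 3 → Fin 3 → ℝ) (dF : Zd 3 → Fin 3 → Fin 3 → Fin 3 → ℝ)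
    (hdF : ∀ x κ μ ν, dF x κ μ ν = (F (x + unitVec κ) μ ν - F x μ ν) - (F (x + unitVec μ) κ ν - F x κ ν) + (F (x + unitVec ν) κ μ - F x κ μ))
    (hanti : ∀ x μ ν, F x ν μ = -F x μ ν) (x : Zd 3) :
    ∑ κ, (dF (x - unitVec κ) κ 1 2 - dF x κ 1 2) = dF (x - unitVec 0) 0 1 2 - dF x 0 1 2 := by
  have hd := diag_eq_zero_of_anti F hanti
  rw [Fin.sum_univ_three, dTwo_diag_left F dF hdF hd, dTwo_diag_left F dF hdF hd,
    dTwo_diag_outer F dF hdF hanti, dTwo_diag_outer F dF hdF hanti]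
  ring

/-- In `d = 3`, for an ANTISYMMETRIC 2-form `F`, `(δ₃d₂F)(x,0,2) = (d₂F)(x−e₁,1,0,2) − (d₂F)(x,1,0,2)`. [folklore] -/
theorem deltaThree_dTwo_fin3_02 (F : Zd 3 → Fin 3 → Fin 3 → ℝ) (dF : Zd 3 → Fin 3 → Fin 3 → Fin 3 → ℝ)
    (hdF : ∀ x κ μ ν, dF x κ μ ν = (F (x + unitVec κ) μ ν - F x μ ν) - (F (x + unitVec μ) κ ν - F x κ ν) + (F (x + unitVec ν) κ μ - F x κ μ))
    (hanti : ∀ x μ ν, F x ν μ = -F x μ ν) (x : Zd 3) :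
    ∑ κ, (dF (x - unitVec κ) κ 0 2 - dF x κ 0 2) = dF (x - unitVec 1) 1 0 2 - dF x 1 0 2 := by
  have hd := diag_eq_zero_of_anti F hanti
  rw [Fin.sum_univ_three, dTwo_diag_left F dF hdF hd, dTwo_diag_left F dF hdF hd,
    dTwo_diag_outer F dF hdF hanti, dTwo_diag_outer F dF hdF hanti]
  ring

/-- In `d = 3`, for an ANTISYMMETRIC 2-form `F`, `(δ₃d₂F)(x,0,1) = (d₂F)(x−e₂,2,0,1) − (d₂F)(x,2,0,1)`. [folklore] -/
theorem deltaThree_dTwo_fin3_01 (F : Zd 3 → Fin 3 → Fin 3 → ℝ) (dF : Zd 3 → Fin 3 → Fin 3 → Fin 3 → ℝ)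
    (hdF : ∀ x κ μ ν, dF x κ μ ν = (F (x + unitVec κ) μ ν - F x μ ν) - (F (x + unitVec μ) κ ν - F x κ ν) + (F (x + unitVec ν) κ μ - F x κ μ))
    (hanti : ∀ x μ ν, F x ν μ = -F x μ ν) (x : Zd 3) :
    ∑ κ, (dF (x - unitVec κ) κ 0 1 - dF x κ 0 1) = dF (x - unitVec 2) 2 0 1 - dF x 2 0 1 := by
  have hd := diag_eq_zero_of_anti F hanti
  rw [Fin.sum_univ_three, dTwo_diag_left F dF hdF hd, dTwo_diag_left F dF hdF hd,
    dTwo_diag_outer F dF hdF hanti, dTwo_diag_outer F dF hdF hanti]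
  ring

/-- In `d = 3`, for an ANTISYMMETRIC 2-form, the three readings agree up to sign: `(d₂F)(x,1,0,2) = −(d₂F)(x,0,1,2)` and `(d₂F)(x,2,0,1) = (d₂F)(x,0,1,2)` —
so `d₂F` IS one scalar, `∇₀F₁₂ − ∇₁F₀₂ + ∇₂F₀₁`. [folklore] -/
theorem dTwo_fin3_components (F : Zd 3 → Fin 3 → Fin 3 → ℝ) (dF : Zd 3 → Fin 3 → Fin 3 → Fin 3 → ℝ)
    (hdF : ∀ x κ μ ν, dF x κ μ ν = (F (x + unitVec κ) μ ν - F x μ ν) - (F (x + unitVec μ) κ ν - F x κ ν) + (F (x + unitVec ν) κ μ - F x κ μ))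
    (hanti : ∀ x μ ν, F x ν μ = -F x μ ν) (x : Zd 3) :
    dF x 1 0 2 = -dF x 0 1 2 ∧ dF x 2 0 1 = dF x 0 1 2 := by
  refine ⟨dTwo_swap_left F dF hdF hanti x 0 1 2, ?_⟩
  rw [dTwo_swap_left F dF hdF hanti x 0 2 1, dTwo_swap_right F dF hdF hanti x 0 1 2]
  ring

end Summit.QuantumFields.YangMills.Theorems.CovariantDischargeLatticeFormsDeg23

end
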